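import Summits.Ventures.PercRepro.ProfilePointedCircuitClassesSixFourteen
import Summits.Ventures.PercRepro.ProfilePointedCircuitClassesInOutFive

/-!
# PercRepro — THE TWELVE-POINT STATEMENT `InOutBottomTwelve` WHEN EVERY CO-RANK-2 QUADRUPLE CONTAINS A SERIES TRIPLE, I:
THE WEIGHTS `×60`, THE UNITS' SIDE, THE NON-DEFICIENT DEMANDS (p5, gen 43; `proofs/P5-GM1.md` §65)

`InOutBottomTwelve` asks `in_5(e) ≤ out_6(e)` on every matroid `N` with `12` points and rank `7`.  In the dual
`M = N✶` (rank `5`, loopless when `N` is coloop-free) the demands are the bases `W ∋ e` with spanning complement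
`B`, the units the spanning `6`-sets avoiding `e` with spanning complement, and a demand is DEFICIENT when `B` has
at most three non-coloops (§63(c)): then `B = K ⊔ P` with `P` a parallel class of three points (four coloops), or
`B = K ⊔ D` with `D` four points of rank `2` without coloops (three coloops).  THIS FILE settles the statement when
the second shape cannot occur: under the hypothesis that EVERY FOUR POINTS OF RANK `2` IN THE DUAL CONTAIN THREE
PAIRWISE PARALLEL POINTS — in `N`: every `4`-set `D` with `ρ(E ∖ D) = 5` contains a `3`-set `P` with `ρ(E ∖ P) = 5`
(a series triple) — the §64 charging goes through verbatim with the weights `×60`: `60 / p(U)` on a disjoint pair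
(`15` for a `(2,0)`-unit), `5` on a clean pair of a deficient demand with a `(2,0)`-unit, `0` otherwise.  Every unit
receives at most `60` (`sum_pwt60_le_sixty`), every demand with at least five non-coloops sends at least `5·12`
(`sixty_le_sum_pwt60_of_five_le`), a demand with exactly four non-coloops does not exist (`nonco_card_ne_four_of_quad`),
and a deficient demand sends at least `60` through its three disjoint units and the clean units `K + p + w`
(`sixty_le_sum_pwt60_of_deficient`: the three units carry a common weight `wt ∈ {15, 12, 20, 30, 60}`, and when
`3·wt < 60` the points `w ∈ cw(W) ∖ {e}` — one of them for `wt = 15`, two for `wt = 12` — supply `3` or `6`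
clean units of weight `5`).  The deficient demands, the assembly and the transfer to `N` are part II (ProfilePointedCircuitClassesTwelveQuadB).

Together with the sparse regime (ProfilePointedCircuitClassesTwelveSparse: no deficient demand at all) this leaves,
of the whole twelve-point statement, exactly the demands `B = K ⊔ D` with `D` a `4`-point rank-`2` set without a
parallel triple — the four-point line, the parallel pair with two further points, and the two parallel pairs (§63(d),
§65: the cases where the type-uniform certificate needs the non-clean pairs).
-/

open scoped Matroid

namespace PercRepro.Cogirth

open Finset ThmH Skew Shadow Profile

variable {α : Type} [DecidableEq α] {M : Matroid α} [M.Finite]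

section TwelveQuad

/-- The integer weight `×60` of the pair (demand `W`, unit `U`): `60 / p(U)` on disjoint pairs (`15` for
`(2,0)`-units), `5` on clean pairs of deficient demands with `(2,0)`-units, `0` otherwise. -/
noncomputable def pwt60 (M : Matroid α) [M.Finite] (S W U : Finset α) : ℕ :=
  if W ∩ U = ∅ then (if type20 M S U then 15 else 60 / pU M S U)
  else (if (W ∩ U).card = 1 ∧ (gr M \ W) \ U = circ5 M (gr M \ U) ∧ type20 M S U ∧ deficient M W then 5
    else 0)

/-- `p(U) ≤ 5` for a singleton `S ⊆ E`: `circ5(Z) ∖ S ⊆ Z ∖ S`, five points. -/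
theorem pU_le_five (hn : (gr M).card = 12) {S : Finset α} (hS : S ⊆ gr M) (hS1 : S.card = 1) {U : Finset α}
    (hU : U ∈ punit M S) : pU M S U ≤ 5 := by
  have hSZ : S ⊆ gr M \ U := subset_sdiff_of_mem_punit hS hU
  rw [mem_punit] at hU
  have hZ6 : (gr M \ U).card = 6 := by rw [card_sdiff_of_subset hU.1, hn, hU.2.1]
  unfold pU
  calc (circ5 M (gr M \ U) \ S).card ≤ ((gr M \ U) \ S).card :=
        card_le_card (sdiff_subset_sdiff (filter_subset _ _) (Subset.refl _))
    _ = 5 := by rw [card_sdiff_of_subset hSZ, hZ6, hS1]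

/-- `p(U) ≤ 6` for every unit (`circ5(Z) ⊆ Z`, six points). -/
theorem pU_le_six (hn : (gr M).card = 12) {S U : Finset α} (hU : U ∈ punit M S) : pU M S U ≤ 6 := by
  rw [mem_punit] at hU
  have hZ6 : (gr M \ U).card = 6 := by rw [card_sdiff_of_subset hU.1, hn, hU.2.1]
  unfold pU
  calc (circ5 M (gr M \ U) \ S).card ≤ (circ5 M (gr M \ U)).card := card_le_card sdiff_subset
    _ ≤ (gr M \ U).card := card_le_card (filter_subset _ _)
    _ = 6 := hZ6

/-- **THE UNITS' SIDE `×60`**: every unit receives at most `60` — `p(U)·(60 / p(U)) ≤ 60` from the disjoint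
demands (or `2·15 = 30` for a `(2,0)`-unit), and at most one clean demand per point of `U` (each `5`, only for
`(2,0)`-units). -/
theorem sum_pwt60_le_sixty (hn : (gr M).card = 12) (hR : rk M (gr M) = 5) {S : Finset α} (hS : S ⊆ gr M)
    {U : Finset α} (hU : U ∈ punit M S) : ∑ W ∈ pdem M S, pwt60 M S W U ≤ 60 := by
  rw [← sum_filter_add_sum_filter_not (pdem M S) (fun W => W ∩ U = ∅)]
  have hU6 : U.card = 6 := (mem_punit.1 hU).2.1
  -- the disjoint demands
  have h1 : ∑ W ∈ (pdem M S).filter (fun W => W ∩ U = ∅), pwt60 M S W U =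
      (if type20 M S U then 30 else pU M S U * (60 / pU M S U)) := by
    have e : ∀ W ∈ (pdem M S).filter (fun W => W ∩ U = ∅),
        pwt60 M S W U = (if type20 M S U then 15 else 60 / pU M S U) := by
      intro W hW
      unfold pwt60
      rw [if_pos (mem_filter.1 hW).2]
    rw [sum_congr rfl e, sum_const, card_filter_pdem_inter_eq hn hR hS hU, smul_eq_mul]
    split_ifs with h20
    · rw [pU_eq_two_of_type20 h20]
    · rfl
  -- the clean demands
  have h2 : ∑ W ∈ (pdem M S).filter (fun W => ¬ W ∩ U = ∅), pwt60 M S W U ≤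
      (if type20 M S U then 30 else 0) := by
    have e : ∀ W ∈ (pdem M S).filter (fun W => ¬ W ∩ U = ∅), pwt60 M S W U =
        (if (W ∩ U).card = 1 ∧ (gr M \ W) \ U = circ5 M (gr M \ U) ∧ type20 M S U ∧ deficient M W then 5
          else 0) := by
      intro W hW
      unfold pwt60
      rw [if_neg (mem_filter.1 hW).2]
    rw [sum_congr rfl e, ← sum_filter, sum_const, smul_eq_mul]
    split_ifs with h20
    · -- at most one clean demand per point of `U`: `W ↦ W ∩ U` is injective
      have hcard : (((pdem M S).filter (fun W => ¬ W ∩ U = ∅)).filter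
            (fun W => (W ∩ U).card = 1 ∧ (gr M \ W) \ U = circ5 M (gr M \ U) ∧ type20 M S U ∧
              deficient M W)).card ≤ 6 := by
        calc _ ≤ (U.powersetCard 1).card := by
              apply card_le_card_of_injOn (fun W => W ∩ U)
              · intro W hW
                rw [mem_coe, mem_filter] at hW
                rw [mem_coe, mem_powersetCard]
                exact ⟨inter_subset_right, hW.2.1⟩
              · intro W₁ hW₁ W₂ hW₂ h
                rw [mem_coe, mem_filter, mem_filter] at hW₁ hW₂
                simp only at h
                have key : ∀ W : Finset α, W ∈ pdem M S → (gr M \ W) \ U = circ5 M (gr M \ U) →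
                    W = ((gr M \ U) \ circ5 M (gr M \ U)) ∪ (W ∩ U) := by
                  intro W hW hcl
                  have hWg : W ⊆ gr M := (mem_pdem.1 hW).1
                  have hsub : W \ U ⊆ gr M \ U := sdiff_subset_sdiff hWg (Subset.refl _)
                  have e1 : (gr M \ U) \ (W \ U) = (gr M \ W) \ U := by
                    ext a
                    simp only [mem_sdiff, not_and, not_not]
                    tauto
                  have e2 : W \ U = (gr M \ U) \ circ5 M (gr M \ U) := by
                    rw [← hcl, ← e1, Finset.sdiff_sdiff_eq_self hsub]
                  rw [← e2, sdiff_union_inter]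
                rw [key W₁ hW₁.1.1 hW₁.2.2.1, key W₂ hW₂.1.1 hW₂.2.2.1, h]
          _ = 6 := by rw [card_powersetCard, Nat.choose_one_right, hU6]
      omega
    · -- no `(2,0)`-unit: the clean condition is never met
      have : (((pdem M S).filter (fun W => ¬ W ∩ U = ∅)).filter
            (fun W => (W ∩ U).card = 1 ∧ (gr M \ W) \ U = circ5 M (gr M \ U) ∧ type20 M S U ∧
              deficient M W)).card = 0 := by
        rw [card_eq_zero, filter_eq_empty_iff]
        intro W _ hW
        exact h20 hW.2.2.1
      rw [this]
  have h3 : (if type20 M S U then 30 else pU M S U * (60 / pU M S U)) +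
      (if type20 M S U then 30 else 0) ≤ 60 := by
    split_ifs
    · norm_num
    · have := Nat.mul_div_le 60 (pU M S U)
      omega
  omega

/-- Every disjoint pair carries weight at least `12` (`p(U) ∈ [1, 5]` for a singleton `S`, or the `(2,0)` weight
`15`). -/
theorem twelve_le_pwt60_of_inter_eq_empty (hn : (gr M).card = 12) (hR : rk M (gr M) = 5) {S : Finset α}
    (hS : S ⊆ gr M) (hS1 : S.card = 1) {W U : Finset α} (hW : W ∈ pdem M S) (hU : U ∈ punit M S)
    (hWU : W ∩ U = ∅) : 12 ≤ pwt60 M S W U := by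
  unfold pwt60
  rw [if_pos hWU]
  split_ifs with h20
  · norm_num
  · have h5 := pU_le_five hn hS hS1 hU
    have h1 : 1 ≤ pU M S U := by
      rw [← card_filter_pdem_inter_eq hn hR hS hU]
      exact card_pos.2 ⟨W, mem_filter.2 ⟨hW, hWU⟩⟩
    interval_cases (pU M S U) <;> norm_num

/-- **A DEMAND WITH AT LEAST FIVE NON-COLOOPS SENDS AT LEAST `60`**: five disjoint units of weight `≥ 12`. -/
theorem sixty_le_sum_pwt60_of_five_le (hn : (gr M).card = 12) (hR : rk M (gr M) = 5) {S : Finset α}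
    (hS : S ⊆ gr M) (hS1 : S.card = 1) {W : Finset α} (hW : W ∈ pdem M S) (h5 : 5 ≤ (nonco M W).card) :
    60 ≤ ∑ U ∈ punit M S, pwt60 M S W U := by
  calc 60 ≤ 12 * ((punit M S).filter (fun U => W ∩ U = ∅)).card := by
        rw [card_filter_punit_inter_eq hn hR hW]; omega
    _ ≤ ∑ U ∈ (punit M S).filter (fun U => W ∩ U = ∅), pwt60 M S W U := by
        rw [mul_comm, ← smul_eq_mul]
        apply card_nsmul_le_sum
        intro U hU
        rw [mem_filter] at hU
        exact twelve_le_pwt60_of_inter_eq_empty hn hR hS hS1 hW hU.1 hU.2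
    _ ≤ ∑ U ∈ punit M S, pwt60 M S W U := sum_le_sum_of_subset (filter_subset _ _)

/-- **NO DEMAND HAS EXACTLY FOUR NON-COLOOPS** when every four points of rank `2` contain three pairwise parallel
ones: `B = K ⊔ nonco(W)` with `K` three coloops gives `ρ(nonco(W)) = 2`; a parallel triple `P ⊆ nonco(W)` leaves a
fourth point `x` with `ρ(B − x) = ρ(K ∪ P) ≤ 4`, so `x` would be a coloop. -/
theorem nonco_card_ne_four_of_quad (hn : (gr M).card = 12)
    (hq : ∀ D ⊆ gr M, D.card = 4 → rk M D = 2 → ∃ P ⊆ D, P.card = 3 ∧ rk M P = 1) {S W : Finset α}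
    (hW : W ∈ pdem M S) : (nonco M W).card ≠ 4 := by
  intro h4
  obtain ⟨hWg, hW5, _, _, hWc⟩ := mem_pdem.1 hW
  have hBg : gr M \ W ⊆ gr M := sdiff_subset
  have hB7 : (gr M \ W).card = 7 := by rw [card_sdiff_of_subset hWg, hn, hW5]
  have hncB : nonco M W ⊆ gr M \ W := filter_subset _ _
  have hco : ∀ b ∈ (gr M \ W) \ nonco M W, rk M ((gr M \ W).erase b) + 1 = rk M (gr M \ W) := by
    intro b hb
    rw [mem_sdiff] at hb
    have hnot : ¬ rk M ((gr M \ W).erase b) = 5 :=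
      fun h => hb.2 (by unfold nonco; exact mem_filter.2 ⟨hb.1, h⟩)
    have h1 := rk_le_rk_erase_add_one (M := M) hBg hb.1
    have h2 := rk_mono' (M := M) (erase_subset b (gr M \ W))
    omega
  have hK := rk_sdiff_add_card_eq_of_forall_coloop hBg sdiff_subset hco ((gr M \ W) \ nonco M W)
    (Subset.refl _)
  rw [Finset.sdiff_sdiff_eq_self hncB, card_sdiff_of_subset hncB, hB7, hWc, h4] at hK
  have hr2 : rk M (nonco M W) = 2 := by omega
  obtain ⟨P, hPD, hP3, hP1⟩ := hq (nonco M W) (hncB.trans hBg) h4 hr2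
  -- the fourth point
  have hx1 : (nonco M W \ P).card = 1 := by rw [card_sdiff_of_subset hPD, h4, hP3]
  obtain ⟨x, hx⟩ := card_eq_one.1 hx1
  have hxmem : x ∈ nonco M W \ P := by rw [hx]; exact mem_singleton_self x
  rw [mem_sdiff] at hxmem
  have hxn : rk M ((gr M \ W).erase x) = 5 := by unfold nonco at hxmem; exact (mem_filter.1 hxmem.1).2
  -- `B − x = K ∪ P`
  have hBx : (gr M \ W).erase x ⊆ ((gr M \ W) \ nonco M W) ∪ P := by
    intro a ha
    rw [mem_erase] at ha
    rw [mem_union, mem_sdiff]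
    by_cases haP : a ∈ P
    · exact Or.inr haP
    · left
      refine ⟨ha.2, fun han => ?_⟩
      have : a ∈ nonco M W \ P := mem_sdiff.2 ⟨han, haP⟩
      rw [hx, mem_singleton] at this
      exact ha.1 this
  have hKcard : ((gr M \ W) \ nonco M W).card = 3 := by rw [card_sdiff_of_subset hncB, hB7, h4]
  have hsub := rk_union_add_rk_inter_le (M := M) ((gr M \ W) \ nonco M W) P
  have hKr := rk_le_card (M := M) ((gr M \ W) \ nonco M W)
  have hmono := rk_mono' (M := M) hBx
  omega

/-- The weight `×60` of the disjoint unit `B − p`, `p ∈ nonco(W)`: `15` for a `(2,0)`-unit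
(`cw(W, p) = {w}` with `w ∉ S`), else `60 / (#(cw(W, p) ∖ S) + 1)`. -/
theorem pwt60_erase_eq {S W : Finset α} (hW : W ∈ pdem M S) {p : α} (hp : p ∈ nonco M W) :
    pwt60 M S W ((gr M \ W).erase p) =
      (if (cw M W p).card = 1 ∧ cw M W p ∩ S = ∅ then 15 else 60 / ((cw M W p \ S).card + 1)) := by
  obtain ⟨hWg, hW5, hSW, hWr, _⟩ := mem_pdem.1 hW
  have hpB : p ∈ gr M \ W := by unfold nonco at hp; exact (mem_filter.1 hp).1
  have hpW : p ∉ W := (mem_sdiff.1 hpB).2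
  have hpS : p ∉ S := fun h => hpW (hSW h)
  have hpcw : p ∉ cw M W p := fun h => hpW (filter_subset _ _ h)
  have hWU : W ∩ (gr M \ W).erase p = ∅ :=
    disjoint_iff_inter_eq_empty.1 (disjoint_of_subset_right (erase_subset _ _) sdiff_disjoint.symm)
  unfold pwt60
  rw [if_pos hWU]
  have hZ : gr M \ (gr M \ W).erase p = insert p W := sdiff_erase_sdiff_eq_insert hWg hpB
  have hc : circ5 M (gr M \ (gr M \ W).erase p) = insert p (cw M W p) := by
    rw [hZ, circ5_insert_eq hWr hpW]
  have ht : type20 M S ((gr M \ W).erase p) ↔ ((cw M W p).card = 1 ∧ cw M W p ∩ S = ∅) := by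
    unfold type20
    rw [hc, card_insert_of_notMem hpcw]
    constructor
    · rintro ⟨h1, h2⟩
      refine ⟨by omega, ?_⟩
      rw [← subset_empty, ← h2]
      exact inter_subset_inter (subset_insert _ _) (Subset.refl _)
    · rintro ⟨h1, h2⟩
      refine ⟨by omega, ?_⟩
      rw [insert_inter_of_notMem hpS, h2]
  have hpU : pU M S ((gr M \ W).erase p) = (cw M W p \ S).card + 1 := by
    unfold pU
    rw [hc, insert_sdiff_of_notMem _ hpS, card_insert_of_notMem (fun h => hpcw (mem_sdiff.1 h).1)]
  by_cases h20 : (cw M W p).card = 1 ∧ cw M W p ∩ S = ∅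
  · rw [if_pos (ht.2 h20), if_pos h20]
  · rw [if_neg (fun h => h20 (ht.1 h)), if_neg h20, hpU]

/-- A pair of weight `1` in the `×12` scale has weight `5` in the `×60` scale (it is a clean pair). -/
theorem pwt60_eq_five_of_pwt_eq_one (hn : (gr M).card = 12) {S W U : Finset α} (hU : U ∈ punit M S)
    (h : pwt M S W U = 1) : pwt60 M S W U = 5 := by
  have h6 := pU_le_six hn hU
  unfold pwt at h
  unfold pwt60
  by_cases hWU : W ∩ U = ∅
  · rw [if_pos hWU] at h
    rw [if_pos hWU]
    by_cases h20 : type20 M S U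
    · rw [if_pos h20] at h
      omega
    · rw [if_neg h20] at h
      exfalso
      have hp1 : 1 ≤ pU M S U := by
        by_contra h0
        have : pU M S U = 0 := by omega
        rw [this] at h
        norm_num at h
      interval_cases (pU M S U) <;> norm_num at h
  · rw [if_neg hWU] at h
    rw [if_neg hWU]
    by_cases hcl : (W ∩ U).card = 1 ∧ (gr M \ W) \ U = circ5 M (gr M \ U) ∧ type20 M S U ∧ deficient M W
    · rw [if_pos hcl]
    · rw [if_neg hcl] at h
      omega

end TwelveQuad

end PercRepro.Cogirth
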